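import Mathlib
import Literature.Geometry.Lorentzian.CoordRicciPerturbation
import Summits.FinalStateConjecture.FinalStateConjecture.Theorems.EIHFluxBalanceInertialRecessionStubSlaving3Perturb

/-!
# Route EIHFluxBalance — `ModulatedKerrHandoff`, stub `stub_dragDefect`: the coordinate Ricci form to second order

Helper file for the crux `stmt-FinalStateConjecture-10167`
(`Summit.FinalStateConjecture.FinalStateConjecture.Theses.EIHFluxBalance.ModulatedKerrHandoff`),
line `overlap-modulation-second-iterate`, stub `stub_dragDefect` (the algebraic engine of the second
iterate: the coordinate Ricci form of the Lie-drag-corrected two-centre Kerr–Schild field).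

The tree's `C²`-perturbation estimate `MetricCoord.IsMetricOn.abs_ricAt_sub_le`
(`Literature.Geometry.Lorentzian.CoordRicciPerturbation`) bounds `Ric(G) − Ric(G')` at a point by ONE
common constant times the `2`-jet of `G − G'`. The drag-defect estimate needs the finer structure of
the same computation (`R − R' = (DΓ − DΓ')(X)(Y) − (DΓ − DΓ')(Y)(X) + riemRem`,
`MetricCoord.riemAt_sub_eq`; `DΓ − DΓ'` from `MetricCoord.IsMetricOn.fderiv_chrAt_sub_apply_eq`):

* the part of `Ric(G) − Ric(G')` which is LINEAR IN THE SECOND DERIVATIVES `T = D²G − D²G'` with the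
  background inverse frozen to an arbitrary `σ : E* → E` — the "principal part"
  `Σᵢ ⟨bᵢ, ½ (σ 𝒦(T bᵢ)(Y, Z) − σ 𝒦(T Y)(bᵢ, Z))⟩` (`𝒦 = koszulOp`, `b` an orthonormal basis) — is
  isolated, and
* the remainder is bounded by monomials each of which carries either a factor of the FIRST or SECOND
  derivatives of the metrics (`a₁ ≥ ‖DG‖, ‖DG'‖`, `a₂ ≥ ‖D²G‖`) or the freezing error `‖♯' − σ‖`:
  `n · ((15 s³ a₁² + 3 s² a₂) ‖G − G'‖ + 15 s² a₁ ‖DG − DG'‖ + 3 ‖♯' − σ‖ ‖D²G − D²G'‖) ‖Y‖ ‖Z‖`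
  (`s ≥ ‖♯‖, ‖♯'‖`; `abs_ricAt_sub_sub_prin_le`).

The principal part is bounded by `3 n ‖σ‖ ‖T‖ ‖Y‖ ‖Z‖` (`abs_prin_le`) and is additive (`prin_add`,
`prin_add_left`). (The jet-sharp estimates of `…InertialRecessionStubSlaving3Perturb` keep the
principal part inside the bound.) Kotschwar 2014, §1.1 (5)–(8); O'Neill 1983, Ch. 3, Lemma 3.38/3.52.
-/

noncomputable section
-- `Summit.<S>.<S>.…` (single-problem summit, D-0017) trips core's duplicate-namespace linter.
set_option linter.dupNamespace false
-- nested operator spaces `E →L E →L E →L ℝ`, as in `Literature.Geometry.Lorentzian.CoordCurvature`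
set_option maxSynthPendingDepth 3
open Set Filter ContinuousLinearMap Module
open scoped Topology ContDiff RealInnerProductSpace
open Literature.Geometry.Lorentzian Literature.Geometry.Lorentzian.MetricCoord
open Summit.FinalStateConjecture.FinalStateConjecture.Theorems.SublinearIsFree.Slaving
  (norm_fderiv_sharpAt_sub_le_jet)

namespace Summit.FinalStateConjecture.FinalStateConjecture.Theorems

namespace DragDefect
/-! ### The difference of the curvature endomorphisms minus its principal part -/

section Difference

variable {E : Type*} [NormedAddCommGroup E] [NormedSpace ℝ E] [CompleteSpace E]
  {G G' : E → E →L[ℝ] E →L[ℝ] ℝ} {V : Set E} {x : E}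

set_option maxHeartbeats 400000 in
/-- **`DΓ − DΓ'` minus its principal part.** For any frozen inverse `σ : E* → E`,
`‖(DΓ − DΓ')(v)(X) − ½ σ ∘ 𝒦((D²G − D²G')v)(X)‖ ≤
 (3 s a₁² ‖♯−♯'‖ + 3 s² a₁ ‖DG−DG'‖ + (3/2) a₂ ‖♯−♯'‖ + (3/2) ‖♯'−σ‖ ‖D²G−D²G'‖) ‖v‖ ‖X‖`
for `‖♯‖, ‖♯'‖ ≤ s`, `‖DG‖, ‖DG'‖ ≤ a₁`, `‖D²G‖ ≤ a₂` (from
`MetricCoord.IsMetricOn.fderiv_chrAt_sub_apply_eq`; the `D♯ − D♯'` term by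
`norm_fderiv_sharpAt_sub_le_jet` of `…StubSlaving3Perturb`). [cite: Kotschwar2014, §1.1 (8)] -/
theorem norm_fderiv_chrAt_sub_sub_prin_le (hG : IsMetricOn G V) (hG' : IsMetricOn G' V)
    (hx : x ∈ V) {s a₁ a₂ : ℝ} (hs : ‖sharpAt G x‖ ≤ s) (hs' : ‖sharpAt G' x‖ ≤ s)
    (h1 : ‖fderiv ℝ G x‖ ≤ a₁) (h1' : ‖fderiv ℝ G' x‖ ≤ a₁) (h2 : ‖fderiv ℝ (fderiv ℝ G) x‖ ≤ a₂)
    (σ : (E →L[ℝ] ℝ) →L[ℝ] E) (v X : E) :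
    ‖fderiv ℝ (chrAt G) x v X - fderiv ℝ (chrAt G') x v X
        - (2⁻¹ : ℝ) • σ.comp (koszulOp ((fderiv ℝ (fderiv ℝ G) x - fderiv ℝ (fderiv ℝ G') x) v) X)‖ ≤
      (3 * s * a₁ ^ 2 * ‖sharpAt G x - sharpAt G' x‖ + 3 * s ^ 2 * a₁ * ‖fderiv ℝ G x - fderiv ℝ G' x‖
        + 2⁻¹ * 3 * a₂ * ‖sharpAt G x - sharpAt G' x‖
        + 2⁻¹ * 3 * ‖sharpAt G' x - σ‖ * ‖fderiv ℝ (fderiv ℝ G) x - fderiv ℝ (fderiv ℝ G') x‖)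
        * ‖v‖ * ‖X‖ := by
  have hs0 : 0 ≤ s := (norm_nonneg _).trans hs
  have ha0 : 0 ≤ a₁ := (norm_nonneg _).trans h1
  have ha2 : 0 ≤ a₂ := (norm_nonneg (fderiv ℝ (fderiv ℝ G) x)).trans h2
  set d₀ := ‖sharpAt G x - sharpAt G' x‖ with hd₀
  set d₁ := ‖fderiv ℝ G x - fderiv ℝ G' x‖ with hd₁
  set d₂ := ‖fderiv ℝ (fderiv ℝ G) x - fderiv ℝ (fderiv ℝ G') x‖ with hd₂
  have hd₀0 : 0 ≤ d₀ := norm_nonneg _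
  have hd₁0 : 0 ≤ d₁ := norm_nonneg _
  have hd₂0 : 0 ≤ d₂ := norm_nonneg (fderiv ℝ (fderiv ℝ G) x - fderiv ℝ (fderiv ℝ G') x)
  -- regroup: the principal term is absorbed into the fourth summand
  have hkos : koszulOp ((fderiv ℝ (fderiv ℝ G) x - fderiv ℝ (fderiv ℝ G') x) v) X =
      koszulOp (fderiv ℝ (fderiv ℝ G) x v) X - koszulOp (fderiv ℝ (fderiv ℝ G') x v) X := by
    rw [_root_.sub_apply, map_sub, _root_.sub_apply]
  have key : fderiv ℝ (chrAt G) x v X - fderiv ℝ (chrAt G') x v X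
        - (2⁻¹ : ℝ) • σ.comp (koszulOp ((fderiv ℝ (fderiv ℝ G) x - fderiv ℝ (fderiv ℝ G') x) v) X) =
      (2⁻¹ : ℝ) • ((fderiv ℝ (sharpAt G) x v - fderiv ℝ (sharpAt G') x v).comp (koszulCLM G x X)
        + (fderiv ℝ (sharpAt G') x v).comp (koszulCLM G x X - koszulCLM G' x X)
        + (sharpAt G x - sharpAt G' x).comp (koszulOp (fderiv ℝ (fderiv ℝ G) x v) X)
        + (sharpAt G' x - σ).comp (koszulOp (fderiv ℝ (fderiv ℝ G) x v) X
            - koszulOp (fderiv ℝ (fderiv ℝ G') x v) X)) := by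
    rw [hG.fderiv_chrAt_sub_apply_eq hG' hx v X, hkos, ← smul_sub]
    congr 1
    simp only [ContinuousLinearMap.sub_comp, ContinuousLinearMap.comp_sub]
    abel
  rw [key, norm_smul, Real.norm_eq_abs, abs_of_pos (by norm_num : (0 : ℝ) < 2⁻¹)]
  -- the four terms
  have hKX : ‖koszulCLM G x X‖ ≤ 3 * a₁ * ‖X‖ :=
    (norm_koszulCLM_apply_le (G := G) X).trans (by gcongr)
  have t1 : ‖(fderiv ℝ (sharpAt G) x v - fderiv ℝ (sharpAt G') x v).comp (koszulCLM G x X)‖ ≤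
      (2 * s * a₁ * d₀ + s ^ 2 * d₁) * ‖v‖ * (3 * a₁ * ‖X‖) :=
    (opNorm_comp_le _ _).trans (mul_le_mul
      (norm_fderiv_sharpAt_sub_le_jet (s := s) (n₁ := a₁) hG hG' hx hs hs' h1 h1' v)
      hKX (norm_nonneg _) (by positivity))
  have hDs' : ‖fderiv ℝ (sharpAt G') x v‖ ≤ s * a₁ * s * ‖v‖ :=
    (hG'.norm_fderiv_sharpAt_apply_le hx v).trans (by gcongr)
  have t2 : ‖(fderiv ℝ (sharpAt G') x v).comp (koszulCLM G x X - koszulCLM G' x X)‖ ≤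
      s * a₁ * s * ‖v‖ * (3 * d₁ * ‖X‖) :=
    (opNorm_comp_le _ _).trans (mul_le_mul hDs'
      (norm_koszulCLM_sub_apply_le (G := G) (G₀ := G') X) (norm_nonneg _) (by positivity))
  have t3 : ‖(sharpAt G x - sharpAt G' x).comp (koszulOp (fderiv ℝ (fderiv ℝ G) x v) X)‖ ≤
      d₀ * (3 * a₂ * ‖v‖ * ‖X‖) :=
    (opNorm_comp_le _ _).trans (mul_le_mul_of_nonneg_left
      ((norm_koszulOp_fderiv_fderiv_apply_le v X).trans (by gcongr)) hd₀0)
  have t4 : ‖(sharpAt G' x - σ).comp (koszulOp (fderiv ℝ (fderiv ℝ G) x v) X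
      - koszulOp (fderiv ℝ (fderiv ℝ G') x v) X)‖ ≤ ‖sharpAt G' x - σ‖ * (3 * d₂ * ‖v‖ * ‖X‖) :=
    (opNorm_comp_le _ _).trans (mul_le_mul_of_nonneg_left
      (norm_koszulOp_fderiv_fderiv_sub_apply_le v X) (norm_nonneg _))
  have hsum := norm_add_le_of_le (norm_add_le_of_le (norm_add_le_of_le t1 t2) t3) t4
  calc _ ≤ 2⁻¹ * ((2 * s * a₁ * d₀ + s ^ 2 * d₁) * ‖v‖ * (3 * a₁ * ‖X‖)
        + s * a₁ * s * ‖v‖ * (3 * d₁ * ‖X‖)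
        + d₀ * (3 * a₂ * ‖v‖ * ‖X‖) + ‖sharpAt G' x - σ‖ * (3 * d₂ * ‖v‖ * ‖X‖)) :=
          mul_le_mul_of_nonneg_left hsum (by norm_num)
    _ = (3 * s * a₁ ^ 2 * d₀ + 3 * s ^ 2 * a₁ * d₁ + 2⁻¹ * 3 * a₂ * d₀
        + 2⁻¹ * 3 * ‖sharpAt G' x - σ‖ * d₂) * ‖v‖ * ‖X‖ := by ring

omit [CompleteSpace E] in
/-- `‖Γ‖ ≤ (3/2) s a₁` for `‖♯‖ ≤ s`, `‖DG‖ ≤ a₁`. [folklore] -/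
theorem opNorm_chrAt_le' {s a₁ : ℝ} (hs : ‖sharpAt G x‖ ≤ s) (h1 : ‖fderiv ℝ G x‖ ≤ a₁) :
    ‖chrAt G x‖ ≤ 2⁻¹ * 3 * s * a₁ := by
  have hs0 : 0 ≤ s := (norm_nonneg _).trans hs
  have ha0 : 0 ≤ a₁ := (norm_nonneg _).trans h1
  refine opNorm_le_bound _ (by positivity) fun X ↦ ?_
  calc ‖chrAt G x X‖ ≤ 2⁻¹ * (‖sharpAt G x‖ * (3 * ‖fderiv ℝ G x‖ * ‖X‖)) := norm_chrAt_apply_le X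
    _ ≤ 2⁻¹ * (s * (3 * a₁ * ‖X‖)) := by gcongr
    _ = 2⁻¹ * 3 * s * a₁ * ‖X‖ := by ring

omit [CompleteSpace E] in
/-- `‖Γ − Γ'‖ ≤ (3/2) (a₁ ‖♯ − ♯'‖ + s ‖DG − DG'‖)` for `‖♯'‖ ≤ s`, `‖DG‖ ≤ a₁`.
[cite: Kotschwar2014, §1.1 (7)] -/
theorem opNorm_chrAt_sub_le' {s a₁ : ℝ} (hs' : ‖sharpAt G' x‖ ≤ s) (h1 : ‖fderiv ℝ G x‖ ≤ a₁) :
    ‖chrAt G x - chrAt G' x‖ ≤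
      2⁻¹ * 3 * (a₁ * ‖sharpAt G x - sharpAt G' x‖ + s * ‖fderiv ℝ G x - fderiv ℝ G' x‖) := by
  have hs0 : 0 ≤ s := (norm_nonneg _).trans hs'
  have ha0 : 0 ≤ a₁ := (norm_nonneg _).trans h1
  refine opNorm_le_bound _ (by positivity) fun X ↦ ?_
  rw [_root_.sub_apply]
  calc ‖chrAt G x X - chrAt G' x X‖
      ≤ 2⁻¹ * (3 * (‖sharpAt G x - sharpAt G' x‖ * ‖fderiv ℝ G x‖
          + ‖sharpAt G' x‖ * ‖fderiv ℝ G x - fderiv ℝ G' x‖) * ‖X‖) :=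
        norm_chrAt_sub_chrAt_apply_le X
    _ ≤ 2⁻¹ * (3 * (‖sharpAt G x - sharpAt G' x‖ * a₁
          + s * ‖fderiv ℝ G x - fderiv ℝ G' x‖) * ‖X‖) := by gcongr
    _ = _ := by ring

/-- **`R − R'` minus its principal part**: for any frozen inverse `σ`,
`‖R(X,Y)Z − R'(X,Y)Z − ½ (σ 𝒦(T X)(Y,·) Z − σ 𝒦(T Y)(X,·) Z)‖ ≤
 (15 s a₁² ‖♯−♯'‖ + 15 s² a₁ ‖DG−DG'‖ + 3 a₂ ‖♯−♯'‖ + 3 ‖♯'−σ‖ ‖T‖) ‖X‖ ‖Y‖ ‖Z‖`, `T = D²G − D²G'`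
(`MetricCoord.riemAt_sub_eq`, `MetricCoord.norm_riemRem_le`). [cite: Kotschwar2014, §1.1 (8)] -/
theorem norm_riemAt_sub_sub_prin_le (hG : IsMetricOn G V) (hG' : IsMetricOn G' V) (hx : x ∈ V)
    {s a₁ a₂ : ℝ} (hs : ‖sharpAt G x‖ ≤ s) (hs' : ‖sharpAt G' x‖ ≤ s)
    (h1 : ‖fderiv ℝ G x‖ ≤ a₁) (h1' : ‖fderiv ℝ G' x‖ ≤ a₁) (h2 : ‖fderiv ℝ (fderiv ℝ G) x‖ ≤ a₂)
    (σ : (E →L[ℝ] ℝ) →L[ℝ] E) (X Y Z : E) :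
    ‖riemAt G x X Y Z - riemAt G' x X Y Z
        - (2⁻¹ : ℝ) • (σ (koszulOp ((fderiv ℝ (fderiv ℝ G) x - fderiv ℝ (fderiv ℝ G') x) X) Y Z)
          - σ (koszulOp ((fderiv ℝ (fderiv ℝ G) x - fderiv ℝ (fderiv ℝ G') x) Y) X Z))‖ ≤
      (15 * s * a₁ ^ 2 * ‖sharpAt G x - sharpAt G' x‖ + 15 * s ^ 2 * a₁ * ‖fderiv ℝ G x - fderiv ℝ G' x‖
        + 3 * a₂ * ‖sharpAt G x - sharpAt G' x‖
        + 3 * ‖sharpAt G' x - σ‖ * ‖fderiv ℝ (fderiv ℝ G) x - fderiv ℝ (fderiv ℝ G') x‖)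
        * ‖X‖ * ‖Y‖ * ‖Z‖ := by
  have hs0 : 0 ≤ s := (norm_nonneg _).trans hs
  have ha0 : 0 ≤ a₁ := (norm_nonneg _).trans h1
  have ha2 : 0 ≤ a₂ := (norm_nonneg (fderiv ℝ (fderiv ℝ G) x)).trans h2
  set T := fderiv ℝ (fderiv ℝ G) x - fderiv ℝ (fderiv ℝ G') x with hT
  set d₀ := ‖sharpAt G x - sharpAt G' x‖ with hd₀
  set d₁ := ‖fderiv ℝ G x - fderiv ℝ G' x‖ with hd₁
  set d₂ := ‖T‖ with hd₂
  have hd₀0 : 0 ≤ d₀ := norm_nonneg _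
  have hd₁0 : 0 ≤ d₁ := norm_nonneg _
  have hd₂0 : 0 ≤ d₂ := norm_nonneg T
  set C := 3 * s * a₁ ^ 2 * d₀ + 3 * s ^ 2 * a₁ * d₁ + 2⁻¹ * 3 * a₂ * d₀
    + 2⁻¹ * 3 * ‖sharpAt G' x - σ‖ * d₂ with hC
  have hC0 : 0 ≤ C := by positivity
  -- the `DA` terms minus their principal parts
  have hDA : ∀ U W : E, ‖(fderiv ℝ (chrAt G) x - fderiv ℝ (chrAt G') x) U W Z
      - (2⁻¹ : ℝ) • σ (koszulOp (T U) W Z)‖ ≤ C * ‖U‖ * ‖W‖ * ‖Z‖ := by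
    intro U W
    have h := norm_fderiv_chrAt_sub_sub_prin_le hG hG' hx hs hs' h1 h1' h2 σ U W
    have heq : (fderiv ℝ (chrAt G) x - fderiv ℝ (chrAt G') x) U W Z
        - (2⁻¹ : ℝ) • σ (koszulOp (T U) W Z) =
        (fderiv ℝ (chrAt G) x U W - fderiv ℝ (chrAt G') x U W
          - (2⁻¹ : ℝ) • σ.comp (koszulOp (T U) W)) Z := by
      simp only [_root_.sub_apply, _root_.smul_apply, ContinuousLinearMap.comp_apply]
    rw [heq]
    calc _ ≤ ‖fderiv ℝ (chrAt G) x U W - fderiv ℝ (chrAt G') x U W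
          - (2⁻¹ : ℝ) • σ.comp (koszulOp (T U) W)‖ * ‖Z‖ := le_opNorm _ _
      _ ≤ C * ‖U‖ * ‖W‖ * ‖Z‖ := by rw [hC]; gcongr
  -- the `A` terms
  have hΓ : ‖chrAt G x‖ ≤ 2⁻¹ * 3 * s * a₁ := opNorm_chrAt_le' hs h1
  have hΓ' : ‖chrAt G' x‖ ≤ 2⁻¹ * 3 * s * a₁ := opNorm_chrAt_le' hs' h1'
  have hA : ‖chrDiff G G' x‖ ≤ 2⁻¹ * 3 * (a₁ * d₀ + s * d₁) := by
    rw [chrDiff_apply]; exact opNorm_chrAt_sub_le' hs' h1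
  have hrem := norm_riemRem_le (G := G) (G' := G') (x := x) hΓ hΓ' X Y Z
  have hrem' : ‖riemRem G G' x X Y Z‖ ≤
      4 * (2⁻¹ * 3 * s * a₁) * (2⁻¹ * 3 * (a₁ * d₀ + s * d₁)) * ‖X‖ * ‖Y‖ * ‖Z‖ :=
    hrem.trans (by gcongr)
  have hsplit : riemAt G x X Y Z - riemAt G' x X Y Z
        - (2⁻¹ : ℝ) • (σ (koszulOp (T X) Y Z) - σ (koszulOp (T Y) X Z)) =
      ((fderiv ℝ (chrAt G) x - fderiv ℝ (chrAt G') x) X Y Z - (2⁻¹ : ℝ) • σ (koszulOp (T X) Y Z))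
        - ((fderiv ℝ (chrAt G) x - fderiv ℝ (chrAt G') x) Y X Z - (2⁻¹ : ℝ) • σ (koszulOp (T Y) X Z))
        + riemRem G G' x X Y Z := by
    rw [riemAt_sub_eq, smul_sub]
    abel
  rw [hsplit]
  calc _ ≤ C * ‖X‖ * ‖Y‖ * ‖Z‖ + C * ‖Y‖ * ‖X‖ * ‖Z‖
        + 4 * (2⁻¹ * 3 * s * a₁) * (2⁻¹ * 3 * (a₁ * d₀ + s * d₁)) * ‖X‖ * ‖Y‖ * ‖Z‖ :=
          norm_add_le_of_le (norm_sub_le_of_le (hDA X Y) (hDA Y X)) hrem'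
    _ = (15 * s * a₁ ^ 2 * d₀ + 15 * s ^ 2 * a₁ * d₁ + 3 * a₂ * d₀
        + 3 * ‖sharpAt G' x - σ‖ * d₂) * ‖X‖ * ‖Y‖ * ‖Z‖ := by rw [hC]; ring

end Difference

/-! ### The Ricci form: difference minus principal part, and the size of the principal part -/

section Ricci

variable {E : Type*} [NormedAddCommGroup E] [InnerProductSpace ℝ E] [FiniteDimensional ℝ E]
  [CompleteSpace E] {ι : Type*} [Fintype ι] {G G' : E → E →L[ℝ] E →L[ℝ] ℝ} {V : Set E} {x : E}

/-- **The coordinate Ricci form to second order.** For two fields of metric components on `V ∋ x`,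
an orthonormal basis `b`, a frozen inverse `σ : E* → E`, and bounds `‖♯‖, ‖♯'‖ ≤ s`,
`‖DG‖, ‖DG'‖ ≤ a₁`, `‖D²G‖ ≤ a₂` at `x`:
`|Ric(Y,Z) − Ric'(Y,Z) − Σᵢ ⟨bᵢ, ½(σ 𝒦(T bᵢ)(Y,Z) − σ 𝒦(T Y)(bᵢ,Z))⟩|
 ≤ |ι| ((15 s³ a₁² + 3 s² a₂) ‖G−G'‖ + 15 s² a₁ ‖DG−DG'‖ + 3 ‖♯'−σ‖ ‖T‖) ‖Y‖ ‖Z‖`, `T = D²G − D²G'`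
at `x`: every non-principal term carries a background derivative, a product of two perturbation jets,
or the freezing error. [cite: Kotschwar2014, §1.1 (5)–(8)] -/
theorem abs_ricAt_sub_sub_prin_le (hG : IsMetricOn G V) (hG' : IsMetricOn G' V) (hx : x ∈ V)
    (b : OrthonormalBasis ι ℝ E) {s a₁ a₂ : ℝ} (hs : ‖sharpAt G x‖ ≤ s) (hs' : ‖sharpAt G' x‖ ≤ s)
    (h1 : ‖fderiv ℝ G x‖ ≤ a₁) (h1' : ‖fderiv ℝ G' x‖ ≤ a₁) (h2 : ‖fderiv ℝ (fderiv ℝ G) x‖ ≤ a₂)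
    (σ : (E →L[ℝ] ℝ) →L[ℝ] E) (Y Z : E) :
    |ricAt G x Y Z - ricAt G' x Y Z
        - ∑ i, ⟪b i, (2⁻¹ : ℝ) • (σ (koszulOp ((fderiv ℝ (fderiv ℝ G) x
              - fderiv ℝ (fderiv ℝ G') x) (b i)) Y Z)
            - σ (koszulOp ((fderiv ℝ (fderiv ℝ G) x - fderiv ℝ (fderiv ℝ G') x) Y) (b i) Z))⟫|
      ≤ Fintype.card ι * (((15 * s ^ 3 * a₁ ^ 2 + 3 * s ^ 2 * a₂) * ‖G x - G' x‖
          + 15 * s ^ 2 * a₁ * ‖fderiv ℝ G x - fderiv ℝ G' x‖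
          + 3 * ‖sharpAt G' x - σ‖ * ‖fderiv ℝ (fderiv ℝ G) x - fderiv ℝ (fderiv ℝ G') x‖)
          * ‖Y‖ * ‖Z‖) := by
  have hs0 : 0 ≤ s := (norm_nonneg _).trans hs
  have ha0 : 0 ≤ a₁ := (norm_nonneg _).trans h1
  have ha2 : 0 ≤ a₂ := (norm_nonneg (fderiv ℝ (fderiv ℝ G) x)).trans h2
  set T := fderiv ℝ (fderiv ℝ G) x - fderiv ℝ (fderiv ℝ G') x with hT
  set d₀ := ‖sharpAt G x - sharpAt G' x‖ with hd₀
  set dH := ‖G x - G' x‖ with hdH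
  set d₁ := ‖fderiv ℝ G x - fderiv ℝ G' x‖ with hd₁
  set d₂ := ‖T‖ with hd₂
  have hdH0 : 0 ≤ dH := norm_nonneg _
  -- `‖♯ − ♯'‖ ≤ s² ‖G − G'‖`
  have hd₀ : d₀ ≤ s ^ 2 * dH := by
    calc d₀ ≤ ‖sharpAt G x‖ * ‖G x - G' x‖ * ‖sharpAt G' x‖ :=
          norm_sharpAt_sub_le (hG.isInvertible x hx) (hG'.isInvertible x hx)
      _ ≤ s * dH * s := by gcongr
      _ = s ^ 2 * dH := by ring
  -- termwise
  have hsub : ricAt G x Y Z - ricAt G' x Y Z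
        - ∑ i, ⟪b i, (2⁻¹ : ℝ) • (σ (koszulOp (T (b i)) Y Z) - σ (koszulOp (T Y) (b i) Z))⟫ =
      ∑ i, ⟪b i, riemAt G x (b i) Y Z - riemAt G' x (b i) Y Z
        - (2⁻¹ : ℝ) • (σ (koszulOp (T (b i)) Y Z) - σ (koszulOp (T Y) (b i) Z))⟫ := by
    rw [ricAt_eq_sum_inner b, ricAt_eq_sum_inner b, ← Finset.sum_sub_distrib,
      ← Finset.sum_sub_distrib]
    refine Finset.sum_congr rfl fun i _ ↦ ?_
    rw [inner_sub_right, inner_sub_right]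
  have hterm : ∀ i, |⟪b i, riemAt G x (b i) Y Z - riemAt G' x (b i) Y Z
      - (2⁻¹ : ℝ) • (σ (koszulOp (T (b i)) Y Z) - σ (koszulOp (T Y) (b i) Z))⟫| ≤
      (15 * s * a₁ ^ 2 * d₀ + 15 * s ^ 2 * a₁ * d₁ + 3 * a₂ * d₀ + 3 * ‖sharpAt G' x - σ‖ * d₂)
        * ‖Y‖ * ‖Z‖ := by
    intro i
    have ha := abs_real_inner_le_norm (b i) (riemAt G x (b i) Y Z - riemAt G' x (b i) Y Z
      - (2⁻¹ : ℝ) • (σ (koszulOp (T (b i)) Y Z) - σ (koszulOp (T Y) (b i) Z)))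
    rw [b.orthonormal.1 i, one_mul] at ha
    have hb' := norm_riemAt_sub_sub_prin_le hG hG' hx hs hs' h1 h1' h2 σ (b i) Y Z
    rw [b.orthonormal.1 i, mul_one] at hb'
    exact ha.trans hb'
  rw [hsub]
  calc _ ≤ ∑ i, |⟪b i, riemAt G x (b i) Y Z - riemAt G' x (b i) Y Z
        - (2⁻¹ : ℝ) • (σ (koszulOp (T (b i)) Y Z) - σ (koszulOp (T Y) (b i) Z))⟫| :=
        Finset.abs_sum_le_sum_abs _ _
    _ ≤ ∑ _i : ι, (15 * s * a₁ ^ 2 * d₀ + 15 * s ^ 2 * a₁ * d₁ + 3 * a₂ * d₀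
        + 3 * ‖sharpAt G' x - σ‖ * d₂) * ‖Y‖ * ‖Z‖ := Finset.sum_le_sum fun i _ ↦ hterm i
    _ = Fintype.card ι * ((15 * s * a₁ ^ 2 * d₀ + 15 * s ^ 2 * a₁ * d₁ + 3 * a₂ * d₀
        + 3 * ‖sharpAt G' x - σ‖ * d₂) * ‖Y‖ * ‖Z‖) := by
        rw [Finset.sum_const, Finset.card_univ, nsmul_eq_mul]
    _ ≤ Fintype.card ι * ((15 * s * a₁ ^ 2 * (s ^ 2 * dH) + 15 * s ^ 2 * a₁ * d₁
        + 3 * a₂ * (s ^ 2 * dH) + 3 * ‖sharpAt G' x - σ‖ * d₂) * ‖Y‖ * ‖Z‖) := by gcongr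
    _ = _ := by ring

omit [CompleteSpace E] [FiniteDimensional ℝ E] in
/-- **Size of the principal part**: `|Σᵢ ⟨bᵢ, ½(σ 𝒦(T bᵢ)(Y,Z) − σ 𝒦(T Y)(bᵢ,Z))⟩| ≤ 3 |ι| ‖σ‖ ‖T‖ ‖Y‖ ‖Z‖`
for any `4`-linear `T` (`‖𝒦(S) X‖ ≤ 3 ‖S‖ ‖X‖`, `MetricCoord.norm_koszulOp_apply_le`). [folklore] -/
theorem abs_prin_le (b : OrthonormalBasis ι ℝ E) (σ : (E →L[ℝ] ℝ) →L[ℝ] E)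
    (T : E →L[ℝ] E →L[ℝ] E →L[ℝ] E →L[ℝ] ℝ) (Y Z : E) :
    |∑ i, ⟪b i, (2⁻¹ : ℝ) • (σ (koszulOp (T (b i)) Y Z) - σ (koszulOp (T Y) (b i) Z))⟫|
      ≤ Fintype.card ι * (3 * ‖σ‖ * ‖T‖ * ‖Y‖ * ‖Z‖) := by
  have hko : ∀ U W : E, ‖σ (koszulOp (T U) W Z)‖ ≤ ‖σ‖ * (3 * ‖T‖ * ‖U‖ * ‖W‖ * ‖Z‖) := by
    intro U W
    calc ‖σ (koszulOp (T U) W Z)‖ ≤ ‖σ‖ * ‖koszulOp (T U) W Z‖ := le_opNorm _ _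
      _ ≤ ‖σ‖ * (‖koszulOp (T U) W‖ * ‖Z‖) := by gcongr; exact le_opNorm _ _
      _ ≤ ‖σ‖ * (3 * ‖T U‖ * ‖W‖ * ‖Z‖) := by gcongr; exact norm_koszulOp_apply_le _ _
      _ ≤ ‖σ‖ * (3 * (‖T‖ * ‖U‖) * ‖W‖ * ‖Z‖) := by gcongr; exact le_opNorm _ _
      _ = _ := by ring
  have hterm : ∀ i, |⟪b i, (2⁻¹ : ℝ) • (σ (koszulOp (T (b i)) Y Z) - σ (koszulOp (T Y) (b i) Z))⟫|
      ≤ 3 * ‖σ‖ * ‖T‖ * ‖Y‖ * ‖Z‖ := by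
    intro i
    have ha := abs_real_inner_le_norm (b i)
      ((2⁻¹ : ℝ) • (σ (koszulOp (T (b i)) Y Z) - σ (koszulOp (T Y) (b i) Z)))
    rw [b.orthonormal.1 i, one_mul] at ha
    refine ha.trans ?_
    rw [norm_smul, Real.norm_eq_abs, abs_of_pos (by norm_num : (0 : ℝ) < 2⁻¹)]
    have h1 := hko (b i) Y
    have h2 := hko Y (b i)
    rw [b.orthonormal.1 i] at h1 h2
    calc _ ≤ 2⁻¹ * (‖σ‖ * (3 * ‖T‖ * 1 * ‖Y‖ * ‖Z‖) + ‖σ‖ * (3 * ‖T‖ * ‖Y‖ * 1 * ‖Z‖)) :=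
          mul_le_mul_of_nonneg_left (norm_sub_le_of_le h1 h2) (by norm_num)
      _ = 3 * ‖σ‖ * ‖T‖ * ‖Y‖ * ‖Z‖ := by ring
  calc _ ≤ ∑ i, |⟪b i, (2⁻¹ : ℝ) • (σ (koszulOp (T (b i)) Y Z) - σ (koszulOp (T Y) (b i) Z))⟫| :=
        Finset.abs_sum_le_sum_abs _ _
    _ ≤ ∑ _i : ι, 3 * ‖σ‖ * ‖T‖ * ‖Y‖ * ‖Z‖ := Finset.sum_le_sum fun i _ ↦ hterm i
    _ = _ := by rw [Finset.sum_const, Finset.card_univ, nsmul_eq_mul]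

omit [CompleteSpace E] [FiniteDimensional ℝ E] in
/-- The principal part is additive in the `4`-linear argument `T`. [folklore] -/
theorem prin_add (b : OrthonormalBasis ι ℝ E) (σ : (E →L[ℝ] ℝ) →L[ℝ] E)
    (T₁ T₂ : E →L[ℝ] E →L[ℝ] E →L[ℝ] E →L[ℝ] ℝ) (Y Z : E) :
    ∑ i, ⟪b i, (2⁻¹ : ℝ) • (σ (koszulOp ((T₁ + T₂) (b i)) Y Z) - σ (koszulOp ((T₁ + T₂) Y) (b i) Z))⟫
      = ∑ i, ⟪b i, (2⁻¹ : ℝ) • (σ (koszulOp (T₁ (b i)) Y Z) - σ (koszulOp (T₁ Y) (b i) Z))⟫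
        + ∑ i, ⟪b i, (2⁻¹ : ℝ) • (σ (koszulOp (T₂ (b i)) Y Z) - σ (koszulOp (T₂ Y) (b i) Z))⟫ := by
  rw [← Finset.sum_add_distrib]
  refine Finset.sum_congr rfl fun i _ ↦ ?_
  rw [← inner_add_right, ← smul_add]
  congr 2
  simp only [_root_.add_apply, map_add]
  abel

omit [CompleteSpace E] [FiniteDimensional ℝ E] in
/-- The principal part is additive in the frozen inverse `σ`. [folklore] -/
theorem prin_add_left (b : OrthonormalBasis ι ℝ E) (σ₁ σ₂ : (E →L[ℝ] ℝ) →L[ℝ] E)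
    (T : E →L[ℝ] E →L[ℝ] E →L[ℝ] E →L[ℝ] ℝ) (Y Z : E) :
    ∑ i, ⟪b i, (2⁻¹ : ℝ) • ((σ₁ + σ₂) (koszulOp (T (b i)) Y Z) - (σ₁ + σ₂) (koszulOp (T Y) (b i) Z))⟫
      = ∑ i, ⟪b i, (2⁻¹ : ℝ) • (σ₁ (koszulOp (T (b i)) Y Z) - σ₁ (koszulOp (T Y) (b i) Z))⟫
        + ∑ i, ⟪b i, (2⁻¹ : ℝ) • (σ₂ (koszulOp (T (b i)) Y Z) - σ₂ (koszulOp (T Y) (b i) Z))⟫ := by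
  rw [← Finset.sum_add_distrib]
  refine Finset.sum_congr rfl fun i _ ↦ ?_
  rw [← inner_add_right, ← smul_add]
  congr 2
  simp only [_root_.add_apply]
  abel

end Ricci

/-- **Registered sub-goal form** (stub `dragDefect_ricci_expansion` of the crux item) of
`abs_ricAt_sub_sub_prin_le` on `E4` with the standard orthonormal basis. [cite: Kotschwar2014, §1.1 (5)–(8)] -/
theorem dragDefect_ricci_expansion : open Literature.Geometry.Lorentzian in ∀ {G G' : E4 → E4 →L[ℝ] E4 →L[ℝ] ℝ} {V : Set E4} {x : E4}, MetricCoord.IsMetricOn G V → MetricCoord.IsMetricOn G' V → x ∈ V → ∀ {s a₁ a₂ : ℝ}, ‖MetricCoord.sharpAt G x‖ ≤ s → ‖MetricCoord.sharpAt G' x‖ ≤ s → ‖fderiv ℝ G x‖ ≤ a₁ → ‖fderiv ℝ G' x‖ ≤ a₁ → ‖fderiv ℝ (fderiv ℝ G) x‖ ≤ a₂ → ∀ (σ : (E4 →L[ℝ] ℝ) →L[ℝ] E4) (Y Z : E4), |MetricCoord.ricAt G x Y Z - MetricCoord.ricAt G' x Y Z - ∑ i, inner ℝ ((EuclideanSpace.basisFun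 (Fin 4) ℝ) i) ((2⁻¹ : ℝ) • (σ (MetricCoord.koszulOp ((fderiv ℝ (fderiv ℝ G) x - fderiv ℝ (fderiv ℝ G') x) ((EuclideanSpace.basisFun (Fin 4) ℝ) i)) Y Z) - σ (MetricCoord.koszulOp ((fderiv ℝ (fderiv ℝ G) x - fderiv ℝ (fderiv ℝ G') x) Y) ((EuclideanSpace.basisFun (Fin 4) ℝ) i) Z)))| ≤ (Fintype.card (Fin 4) : ℝ) * (((15 * s ^ 3 * a₁ ^ 2 + 3 * s ^ 2 * a₂) * ‖G x - G' x‖ + 15 * s ^ 2 * a₁ * ‖fderiv ℝ G x - fderiv ℝ G' x‖ + 3 * ‖MetricCoord.sharpAt G' x - σ‖ * ‖fderiv ℝ (fderiv ℝ G) x - fderiv ℝ (fderiv ℝ G') x‖) * ‖Y‖ * ‖Z‖) :=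
  fun hG hG' hx _ _ _ hs hs' h1 h1' h2 σ Y Z ↦
    abs_ricAt_sub_sub_prin_le hG hG' hx (EuclideanSpace.basisFun (Fin 4) ℝ) hs hs' h1 h1' h2 σ Y Z

end DragDefect

end Summit.FinalStateConjecture.FinalStateConjecture.Theorems

end
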